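import Summits.MatrixMultiplication.OmegaCensus.DominoZpZpEnum
import Literature.Computability.Complexity.BlockTuples
import HarnessLib

/-!
# Margin-pruned kernel enumeration on `ZMod p × ZMod p`: the semantic cover statement (generic in `p`)

ω-census `pub-omega`, family (b3), seat pub-omega-group gen 20.  Framing: lottery ticket; floor = certified bounds/negative
ranges.  VALUE: `exists_entry_of_cover`, the bridge from the kernel programs of `DominoZpZpEnum.lean` (`coverNF1/2/3`,
`soundChk`) to the cover hypothesis of the `ℤ_p × ℤ_p` domino cell theorems (`DominoZpZpCells.lean`); NOT progress on ω.

For `g : Fin (p²) → ℕ` the rows `rowsOf g`, the row-sum vector `rowSums g` (= count vector of direction `0`,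
`cnts_zero_eq_rowSums`) and the count vectors `cnts p j g` are related to the accumulated codes by `code_eq_polyBE` and
`getD_accsAfter_rowsOf`; `exists_entry_of_cover` then runs the three normal-form cases through `coverGen_spec`.
-/

namespace Summit.MatrixMultiplication.OmegaCensus

open Finset

namespace ZpZpDomino

/-! ## Semantic form -/

section Semantic

variable {p : ℕ} [NeZero p]

/-- The cell `(t, u)` of the `p × p` grid as an index `u + p·t` of `Fin (p²)`. [folklore] -/
def cell (t u : Fin p) : Fin (p * p) := finProdFinEquiv (t, u)

omit [NeZero p] in
/-- The value of `cell`. [folklore] -/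
theorem cell_val (t u : Fin p) : (cell t u).val = t.val * p + u.val := by
  rw [cell, finProdFinEquiv_apply_val]; ring

omit [NeZero p] in
/-- A sum over `Fin (p²)` as a double sum over the grid. [folklore] -/
theorem sum_eq_sum_cell (G : Fin (p * p) → ℕ) : ∑ i, G i = ∑ t : Fin p, ∑ u : Fin p, G (cell t u) := by
  rw [← Fintype.sum_prod_type']
  exact (Fintype.sum_equiv finProdFinEquiv (fun x => G (cell x.1 x.2)) G fun x => rfl).symm

/-- The count vector of direction `j`. [folklore] -/
def cnts (p j : ℕ) (g : Fin (p * p) → ℕ) : List ℕ := List.ofFn fun v : Fin p => ∑ i, pick v.val (pv p j i.val) (g i)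

omit [NeZero p] in
/-- Length of `cnts`. [folklore] -/
@[simp] theorem length_cnts (j : ℕ) (g : Fin (p * p) → ℕ) : (cnts p j g).length = p := by simp [cnts]

/-- Sum of `cnts`: every cell is counted once. [folklore] -/
theorem sum_cnts (j : ℕ) (g : Fin (p * p) → ℕ) : (cnts p j g).sum = ∑ i, g i := by
  rw [cnts, List.sum_ofFn, sum_comm]
  refine Fintype.sum_congr _ _ fun i => ?_
  rw [Finset.sum_eq_single ⟨pv p j i.val, pv_lt p j i.val⟩]
  · simp [pick]
  · intro v _ hv
    simp only [pick]
    rw [if_neg]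
    intro e; apply hv; exact Fin.ext e.symm
  · simp

/-- **Code identity**: `Σ_i g i · B^{p−1−pv j i} = polyBE B (cnts j g)`. [folklore] -/
theorem code_eq_polyBE (B j : ℕ) (g : Fin (p * p) → ℕ) :
    ∑ i, g i * B ^ (p - 1 - pv p j i.val) = polyBE B (cnts p j g) := by
  rw [cnts, polyBE_ofFn]
  simp only [sum_mul]
  rw [sum_comm]
  refine Fintype.sum_congr _ _ fun i => ?_
  rw [Finset.sum_eq_single ⟨pv p j i.val, pv_lt p j i.val⟩]
  · simp [pick]
  · intro v _ hv
    simp only [pick]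
    rw [if_neg, zero_mul]
    intro e; apply hv; exact Fin.ext e.symm
  · simp

/-- The rows of `g` as lists. [folklore] -/
def rowsOf (g : Fin (p * p) → ℕ) : List (List ℕ) := List.ofFn fun t : Fin p => List.ofFn fun u : Fin p => g (cell t u)

/-- The row-sum vector of `g`. [folklore] -/
def rowSums (g : Fin (p * p) → ℕ) : List ℕ := List.ofFn fun t : Fin p => ∑ u : Fin p, g (cell t u)

/-- The row-sum vector is the count vector of direction `0`. [folklore] -/
theorem cnts_zero_eq_rowSums (g : Fin (p * p) → ℕ) : cnts p 0 g = rowSums g := by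
  unfold cnts rowSums
  congr 1
  funext v
  rw [sum_eq_sum_cell]
  have hp : 0 < p := Nat.pos_of_ne_zero (NeZero.ne p)
  have hdiv : ∀ t u : Fin p, pv p 0 (cell t u).val = t.val := fun t u => by
    rw [pv_zero, cell_val, show t.val * p + u.val = u.val + t.val * p by ring, Nat.add_mul_div_right _ _ hp,
      Nat.div_eq_of_lt u.isLt, zero_add, Nat.mod_eq_of_lt t.isLt]
  have key : ∀ t : Fin p, ∑ u, pick v.val (pv p 0 (cell t u).val) (g (cell t u)) =
      if t = v then ∑ u, g (cell v u) else 0 := by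
    intro t
    split_ifs with htv
    · subst htv
      exact Fintype.sum_congr _ _ fun u => by simp [pick, hdiv]
    · exact Fintype.sum_eq_zero _ fun u => by simp [pick, hdiv t u, Fin.val_ne_of_ne htv]
  rw [Fintype.sum_congr _ _ key, Finset.sum_ite_eq' univ v, if_pos (mem_univ _)]

omit [NeZero p] in
/-- Length of `rowsOf`. [folklore] -/
@[simp] theorem length_rowsOf (g : Fin (p * p) → ℕ) : (rowsOf g).length = p := by simp [rowsOf]

omit [NeZero p] in
/-- Rows of `rowsOf`. [folklore] -/
theorem getD_rowsOf (g : Fin (p * p) → ℕ) {t : ℕ} (ht : t < p) :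
    (rowsOf g).getD t [] = List.ofFn fun u : Fin p => g (cell ⟨t, ht⟩ u) :=
  Literature.Computability.Complexity.getD_ofFn _ _ ht

omit [NeZero p] in
/-- Length of `rowSums`. [folklore] -/
@[simp] theorem length_rowSums (g : Fin (p * p) → ℕ) : (rowSums g).length = p := by simp [rowSums]

omit [NeZero p] in
/-- Entries of `rowSums`. [folklore] -/
theorem getD_rowSums (g : Fin (p * p) → ℕ) {t : ℕ} (ht : t < p) :
    (rowSums g).getD t 0 = ∑ u : Fin p, g (cell ⟨t, ht⟩ u) :=
  Literature.Computability.Complexity.getD_ofFn _ _ ht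

omit [NeZero p] in
/-- Sum of `rowSums`. [folklore] -/
theorem sum_rowSums (g : Fin (p * p) → ℕ) : (rowSums g).sum = ∑ i, g i := by
  rw [rowSums, List.sum_ofFn, sum_eq_sum_cell]

omit [NeZero p] in
/-- A function on `Fin n` vanishing off `0` lists as `[Σ f, 0, …, 0]`. [folklore] -/
theorem ofFn_eq_cons_replicate {n : ℕ} (hn : 1 ≤ n) (f : Fin n → ℕ) (h : ∀ u : Fin n, u.val ≠ 0 → f u = 0) :
    List.ofFn f = (∑ u, f u) :: List.replicate (n - 1) 0 := by
  obtain ⟨n, rfl⟩ : ∃ n', n = n' + 1 := ⟨n - 1, by omega⟩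
  rw [List.ofFn_succ, Fin.sum_univ_succ, Fintype.sum_eq_zero (fun i : Fin n => f i.succ) fun u => h u.succ (by simp),
    add_zero]
  simp only [Nat.add_sub_cancel, List.cons.injEq, true_and]
  rw [show (fun i : Fin n => f i.succ) = fun _ => 0 from funext fun u => h u.succ (by simp), List.ofFn_const]

omit [NeZero p] in
/-- **The code of direction `j` accumulated over the rows of `g`.** [folklore] -/
theorem getD_accsAfter_rowsOf (B : ℕ) (g : Fin (p * p) → ℕ) {j : ℕ} (hj : j < p + 1) :
    (accsAfter (rowWs p B) (List.replicate (p + 1) 0) (rowsOf g)).getD j 0 =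
      ∑ i, g i * B ^ (p - 1 - pv p j i.val) := by
  have hws : ∀ w ∈ rowWs p B, ∀ x ∈ w, x.length = (List.replicate (p + 1) 0).length := by
    intro w hw x hx
    simp only [rowWs, List.mem_map, List.mem_range] at hw
    obtain ⟨t, -, rfl⟩ := hw
    simp only [rowW, List.mem_map, List.mem_range] at hx
    obtain ⟨u, -, rfl⟩ := hx
    simp
  rw [getD_accsAfter (rowWs p B) _ (rowsOf g) hws (by simp) (fun t ht => by
      rw [length_rowsOf] at ht
      rw [getD_rowWs p B ht, getD_rowsOf g ht, length_rowW, List.length_ofFn]) (by simpa using hj)]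
  rw [List.getD_eq_getElem _ _ (by simpa using hj), List.getElem_replicate, zero_add, length_rowsOf, sum_range,
    sum_eq_sum_cell]
  refine Fintype.sum_congr _ _ fun t => ?_
  rw [getD_rowsOf g t.isLt, List.length_ofFn, sum_range, getD_rowWs p B t.isLt]
  refine Fintype.sum_congr _ _ fun u => ?_
  rw [Literature.Computability.Complexity.getD_ofFn _ _ u.isLt, getD_rowW p B t.val u.isLt, getD_wt p B _ hj, cell_val]

/-- The count vectors are compositions of `Σ g`. [folklore] -/
theorem cnts_mem_compsLB (j : ℕ) (g : Fin (p * p) → ℕ) : cnts p j g ∈ compsLB [] p (∑ i, g i) :=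
  mem_compsLB [] p _ _ (length_cnts j g) (sum_cnts j g) fun k _ => by simp

/-- **From the cover programs to an unflagged direction**: some direction `j ≤ p` has a count vector whose code is NOT
flagged by `tree` (nothing about `tree` is assumed). [folklore] -/
theorem exists_unflagged_of_cover (hp : 2 ≤ p) {d : ℕ} (tree : BTree)
    {K m : ℕ} (hm : 0 < m) (h1 : ∀ k < m, coverNF1 p d tree K m k = true) (h2 : coverNF2 p d tree = true)
    (h3 : coverNF3 p d tree = true) (i10 i01 : Fin (p * p)) (h10 : i10.val = p) (h01 : i01.val = 1)
    (g : Fin (p * p) → ℕ) (hg : ∑ i, g i = d)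
    (hNF : (1 ≤ g i10 ∧ 1 ≤ g i01) ∨ (1 ≤ g i10 ∧ ∀ i : Fin (p * p), i.val % p ≠ 0 → g i = 0) ∨
      (∀ i : Fin (p * p), i.val ≠ 0 → g i = 0)) :
    ∃ j < p + 1, tree.mem (polyBE (d + 1) (cnts p j g)) = false := by
  have hp0 : 0 < p := by omega
  -- (a) the target shape
  have suff : ∀ j < p + 1, tree.mem (polyBE (d + 1) (cnts p j g)) = false →
      ∃ j < p + 1, tree.mem (polyBE (d + 1) (cnts p j g)) = false := fun j hj h => ⟨j, hj, h⟩
  -- (b) a passing leaf gives such a code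
  have fromLeaf : (accsAfter (rowWs p (d + 1)) (List.replicate (p + 1) 0) (rowsOf g)).any
      (fun a => !(tree.mem a)) = true → ∃ j < p + 1, tree.mem (polyBE (d + 1) (cnts p j g)) = false := by
    intro hany
    rw [List.any_eq_true] at hany
    obtain ⟨a, ha, hfa⟩ := hany
    obtain ⟨j, hj, rfl⟩ := List.getElem_of_mem ha
    have hws : ∀ w ∈ rowWs p (d + 1), ∀ x ∈ w, x.length = (List.replicate (p + 1) 0).length := by
      intro w hw x hx
      simp only [rowWs, List.mem_map, List.mem_range] at hw
      obtain ⟨t, -, rfl⟩ := hw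
      simp only [rowW, List.mem_map, List.mem_range] at hx
      obtain ⟨u, -, rfl⟩ := hx
      simp
    have hlen : (accsAfter (rowWs p (d + 1)) (List.replicate (p + 1) 0) (rowsOf g)).length = p + 1 := by
      rw [length_accsAfter _ _ _ hws, List.length_replicate]
    have hj' : j < p + 1 := by rw [← hlen]; exact hj
    apply suff j hj'
    have e := getD_accsAfter_rowsOf (d + 1) g hj'
    rw [List.getD_eq_getElem _ _ hj] at e
    rw [← code_eq_polyBE, ← e]
    simpa using hfa
  -- (c) the row-sum vector
  have hRlen : (rowSums g).length = p := length_rowSums g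
  have hRsum : (rowSums g).sum = d := by rw [sum_rowSums, hg]
  have hRle : ∀ t < p, (rowSums g).getD t 0 < d + 1 := fun t ht => by
    have : (rowSums g).getD t 0 ≤ (rowSums g).sum := by
      rw [List.getD_eq_getElem _ _ (by rw [hRlen]; exact ht)]
      exact List.le_sum_of_mem (List.getElem_mem _)
    omega
  have fromR : tree.mem (polyBE (d + 1) (rowSums g)) = false →
      ∃ j < p + 1, tree.mem (polyBE (d + 1) (cnts p j g)) = false := fun h =>
    suff 0 (by omega) (by rw [cnts_zero_eq_rowSums]; exact h)
  -- cells of the two normal-form points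
  have hc01 : cell (⟨0, hp0⟩ : Fin p) ⟨1, by omega⟩ = i01 := Fin.ext (by rw [cell_val, h01]; simp)
  have hc10 : cell (⟨1, by omega⟩ : Fin p) ⟨0, hp0⟩ = i10 := Fin.ext (by rw [cell_val, h10]; simp)
  -- rows of `g` as compositions
  have hrow : ∀ (lb : List ℕ) (t : ℕ) (ht : t < p),
      (∀ k < p, ∀ hk : k < p, lb.getD k 0 ≤ g (cell ⟨t, ht⟩ ⟨k, hk⟩)) →
      (rowsOf g).getD t [] ∈ (tabOf lb p d).getD ((rowSums g).getD t 0) [] := by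
    intro lb t ht hlb
    rw [getD_tabOf lb p d (hRle t ht), getD_rowsOf g ht]
    refine mem_compsLB lb p _ _ (List.length_ofFn) (by rw [List.sum_ofFn, getD_rowSums g ht]) fun k hk => ?_
    rw [Literature.Computability.Complexity.getD_ofFn _ _ hk]
    exact hlb k hk hk
  rcases hNF with ⟨h10', h01'⟩ | ⟨h10', hax⟩ | h0
  · -- normal form (i)
    have hRmem : rowSums g ∈ (compsLB [1, 1] p d).filter fun R => polyBE K R % m = polyBE K (rowSums g) % m := by
      rw [List.mem_filter]
      refine ⟨mem_compsLB [1, 1] p d _ hRlen hRsum fun k hk => ?_, by simp⟩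
      rcases k with _ | _ | k
      · rw [getD_rowSums g hp0]
        simpa using le_trans h01' (hc01 ▸ single_le_sum (f := fun u => g (cell ⟨0, hp0⟩ u))
          (fun _ _ => Nat.zero_le _) (mem_univ _))
      · rw [getD_rowSums g (by omega : 1 < p)]
        simpa using le_trans h10' (hc10 ▸ single_le_sum (f := fun u => g (cell ⟨1, by omega⟩ u))
          (fun _ _ => Nat.zero_le _) (mem_univ _))
      · simp
    have htabs : ([tabOf [0, 1] p d, tabOf [1] p d] ++ List.replicate (p - 2) (tabOf [] p d)).length = p := by
      simp; omega
    rcases coverGen_spec (h1 _ (Nat.mod_lt _ hm)) (by rw [htabs, length_rowWs]) _ hRmem (by rw [htabs, hRlen])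
      with hR | hM
    · exact fromR hR
    · refine fromLeaf (hM (rowsOf g) (by rw [length_rowsOf, hRlen]) fun t ht => ?_)
      rw [hRlen] at ht
      rcases t with _ | _ | t
      · simp only [List.cons_append, List.getD_cons_zero]
        refine hrow [0, 1] 0 hp0 fun k _ hk => ?_
        rcases k with _ | _ | k
        · simp
        · have hc : cell (⟨0, hp0⟩ : Fin p) ⟨1, hk⟩ = i01 := Fin.ext (by rw [cell_val, h01]; simp)
          rw [hc]; exact h01'
        · simp
      · simp only [List.cons_append, List.getD_cons_succ, List.getD_cons_zero]
        refine hrow [1] 1 ht fun k _ hk => ?_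
        rcases k with _ | k
        · have hc : cell (⟨1, ht⟩ : Fin p) ⟨0, hk⟩ = i10 := Fin.ext (by rw [cell_val, h10]; simp)
          rw [hc]; exact h10'
        · simp
      · have htl : t < (List.replicate (p - 2) (tabOf [] p d)).length := by rw [List.length_replicate]; omega
        simp only [List.cons_append, List.nil_append, List.getD_cons_succ]
        rw [List.getD_eq_getElem (List.replicate (p - 2) (tabOf [] p d)) [] htl, List.getElem_replicate]
        exact hrow [] (t + 2) ht fun k _ hk => by simp
  · -- normal form (ii)
    have hrow2 : ∀ t < p, (rowsOf g).getD t [] ∈ (tabAxis p d).getD ((rowSums g).getD t 0) [] := by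
      intro t ht
      rw [getD_tabAxis p d (hRle t ht), getD_rowsOf g ht, getD_rowSums g ht, List.mem_singleton]
      exact ofFn_eq_cons_replicate (by omega) _ fun u hu => hax _ (by
        rw [cell_val, show t * p + u.val = u.val + t * p by ring, Nat.add_mul_mod_self_right,
          Nat.mod_eq_of_lt u.isLt]; exact hu)
    have hRmem : rowSums g ∈ compsLB [0, 1] p d := by
      refine mem_compsLB [0, 1] p d _ hRlen hRsum fun k hk => ?_
      rcases k with _ | _ | k
      · simp
      · rw [getD_rowSums g (by omega : 1 < p)]
        simpa using le_trans h10' (hc10 ▸ single_le_sum (f := fun u => g (cell ⟨1, by omega⟩ u))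
          (fun _ _ => Nat.zero_le _) (mem_univ _))
      · simp
    rcases coverGen_spec h2 (by simp) _ hRmem (by simp [hRlen]) with hR | hM
    · exact fromR hR
    · refine fromLeaf (hM (rowsOf g) (by rw [length_rowsOf, hRlen]) fun t ht => ?_)
      rw [hRlen] at ht
      rw [List.getD_eq_getElem (List.replicate p (tabAxis p d)) [] (by simpa using ht), List.getElem_replicate]
      exact hrow2 t ht
  · -- normal form (iii)
    have hax : ∀ i : Fin (p * p), i.val % p ≠ 0 → g i = 0 := fun i hi => h0 i fun e => hi (by rw [e]; simp)
    have hrow2 : ∀ t < p, (rowsOf g).getD t [] ∈ (tabAxis p d).getD ((rowSums g).getD t 0) [] := by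
      intro t ht
      rw [getD_tabAxis p d (hRle t ht), getD_rowsOf g ht, getD_rowSums g ht, List.mem_singleton]
      exact ofFn_eq_cons_replicate (by omega) _ fun u hu => hax _ (by
        rw [cell_val, show t * p + u.val = u.val + t * p by ring, Nat.add_mul_mod_self_right,
          Nat.mod_eq_of_lt u.isLt]; exact hu)
    have hReq : rowSums g = d :: List.replicate (p - 1) 0 := by
      rw [rowSums, ofFn_eq_cons_replicate (by omega) _ fun t ht => Fintype.sum_eq_zero _ fun u => h0 _ (by
        rw [cell_val]; positivity), ← sum_eq_sum_cell, hg]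
    have hRmem : rowSums g ∈ [d :: List.replicate (p - 1) 0] := by rw [hReq]; exact List.mem_singleton_self _
    rcases coverGen_spec h3 (by simp) _ hRmem (by simp [hRlen]) with hR | hM
    · exact fromR hR
    · refine fromLeaf (hM (rowsOf g) (by rw [length_rowsOf, hRlen]) fun t ht => ?_)
      rw [hRlen] at ht
      rw [List.getD_eq_getElem (List.replicate p (tabAxis p d)) [] (by simpa using ht), List.getElem_replicate]
      exact hrow2 t ht

/-- **From the cover programs to the semantic statement.**  `hT` is the ONLY fact used about `tree`: a composition of
`d` whose code is unflagged is the count vector of a table entry (decided per table, `soundChk`). [folklore] -/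
theorem exists_entry_of_cover (hp : 2 ≤ p) {d : ℕ} (T : List (List ℕ × List (ℕ × List ℕ))) (tree : BTree)
    (hT : ∀ c ∈ compsLB [] p d, tree.mem (polyBE (d + 1) c) = false → ∃ e ∈ T, e.1 = c)
    {K m : ℕ} (hm : 0 < m) (h1 : ∀ k < m, coverNF1 p d tree K m k = true) (h2 : coverNF2 p d tree = true)
    (h3 : coverNF3 p d tree = true) (i10 i01 : Fin (p * p)) (h10 : i10.val = p) (h01 : i01.val = 1)
    (g : Fin (p * p) → ℕ) (hg : ∑ i, g i = d)
    (hNF : (1 ≤ g i10 ∧ 1 ≤ g i01) ∨ (1 ≤ g i10 ∧ ∀ i : Fin (p * p), i.val % p ≠ 0 → g i = 0) ∨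
      (∀ i : Fin (p * p), i.val ≠ 0 → g i = 0)) :
    ∃ j < p + 1, ∃ e ∈ T, ∀ v < p, e.1.getD v 0 = ∑ i : Fin (p * p), pick v (pv p j i.val) (g i) := by
  obtain ⟨j, hj, hmem⟩ := exists_unflagged_of_cover hp tree hm h1 h2 h3 i10 i01 h10 h01 g hg hNF
  obtain ⟨e, he, he1⟩ := hT _ (hg ▸ cnts_mem_compsLB j g) hmem
  refine ⟨j, hj, e, he, fun v hv => ?_⟩
  rw [he1, cnts, Literature.Computability.Complexity.getD_ofFn _ _ hv]

end Semantic


end ZpZpDomino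

end Summit.MatrixMultiplication.OmegaCensus
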